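import Summits.Ventures.Crystal3D.Theorems.StickyWulffConstantNoReconstructionGainCapCountsSharp
import Summits.Ventures.Crystal3D.Theorems.StickyWulffConstantNoReconstructionGainTopRowNine
import HarnessLib

/-!
# The top-ball row of the `W = √(2/3)` certificate for SEVEN partners
# (crux `NoReconstructionGain`, stmt-Ventures-19144, line `replication-exactness`, inside `stub_noCriminal`)

HONEST FRAMING. Venture `Summits/Ventures/Crystal3D` (cell `crystal3d-full`), helper `--supports` the crux
`NoReconstructionGain` (stmt-Ventures-19144), lead wulff-p1 g24.  One more row of the pointwise certificate for
bilayer-confined `(111)` films; not a film theorem; crux and rung F-C1 not moved.  `c = √(2/3)`.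
`topRow_ramp_of_card_ne` did the top-ball row (offset `a = −c`) for every partner count except `7, 8`; this file
does `7`: `sum_height_le_five_of_seven` (seven cap-zone code vectors have `Σ u₂ ≤ 5c`: cap counts
`≥ 0.71/0.535/0.28/0.2 ↦ ≤ 3/4/5/6` + a staircase; if three vectors are `≥ 0.71`, a four-point azimuth pigeonhole
`exists_pair_arc_le` pairs the highest remaining vector `r` with a high `h` within `90°`, so `z_h z_r ≤ 1/2`,
`z_h + z_r ≤ c + 1/(2c)`, and `3c + 1/(2c) + 1.015 ≤ 5c` with margin `0.0056`), its reflection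
`sum_depth_le_five_of_seven`, and **`topRow_ramp_seven`**.  Left at `a = −c`: eight partners (slack `≈ 0.3c`;
the thresholds alone give `4.27 > 4c`, so it needs a joint argument or a certificate — memo HOLLOW-g24 §2b).
-/

noncomputable section

namespace Summit.Ventures.Crystal3D.Theorems

open Finset Real
open scoped InnerProductSpace


/-- `⟪x, y⟫ = x₀y₀ + x₁y₁ + x₂y₂` in `ℝ³` (local copy). -/
private theorem inner_three_t7 (x y : EuclideanSpace ℝ (Fin 3)) :
    ⟪x, y⟫_ℝ = x 0 * y 0 + x 1 * y 1 + x 2 * y 2 := by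
  simp [PiLp.inner_apply, Fin.sum_univ_three, mul_comm]

/-- The horizontal part of a unit vector of height `z` has norm `√(1 − z²)` (local copy). -/
private theorem norm_horiz_t7 {u : EuclideanSpace ℝ (Fin 3)} (hu : ‖u‖ = 1) :
    ‖(⟨u 0, u 1⟩ : ℂ)‖ = Real.sqrt (1 - u 2 ^ 2) := by
  have h2 : ‖(⟨u 0, u 1⟩ : ℂ)‖ ^ 2 = 1 - u 2 ^ 2 := by
    rw [Complex.sq_norm, Complex.normSq_mk]
    have h := real_inner_self_eq_norm_sq u
    rw [inner_three_t7, hu, one_pow] at h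
    nlinarith [h]
  rw [← h2, Real.sqrt_sq (norm_nonneg _)]

/-- **Four-point pigeonhole via the walk.**  Among at least `n ≥ 2` members of a finite family with azimuths
`t`, two distinct members `a, b` with `t a ≤ t b` have `t b − t a ≤ 2π/n` or `2π − (t b − t a) ≤ 2π/n`. -/
theorem exists_pair_arc_le {ι : Type*} [DecidableEq ι] (S : Finset ι) (t : ι → ℝ) {n : ℕ} (hn : 2 ≤ n)
    (hS : n ≤ S.card) :
    ∃ a ∈ S, ∃ b ∈ S, a ≠ b ∧ t a ≤ t b ∧ (t b - t a ≤ 2 * π / n ∨ 2 * π - (t b - t a) ≤ 2 * π / n) := by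
  by_contra hno
  push Not at hno
  have hn0 : (0 : ℝ) < n := by exact_mod_cast (show 0 < n by omega)
  have hSne : S.Nonempty := by rw [← Finset.card_pos]; omega
  have hgap : ∀ a ∈ S, ∀ b ∈ S, a ≠ b → t a ≤ t b → π / n + π / n ≤ t b - t a := by
    intro a ha b hb hab htab
    have h := (hno a ha b hb hab htab).1
    have : 2 * π / n = π / n + π / n := by ring
    linarith
  obtain ⟨lo, hlo, hi, hhi, h1, -, h3⟩ := azimuth_weighted_walk t (fun _ => π / n) S hgap hSne
  rw [sum_const, nsmul_eq_mul] at h3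
  have hcard : (n : ℝ) ≤ S.card := by exact_mod_cast hS
  have h2n : (2 : ℝ) ≤ n := by exact_mod_cast hn
  have hπn : 0 < π / n := div_pos pi_pos hn0
  have hnπ : (n : ℝ) * (π / n) = π := by field_simp
  have hkey : π ≤ (S.card : ℝ) * (π / n) :=
    calc π = (n : ℝ) * (π / n) := hnπ.symm
      _ ≤ (S.card : ℝ) * (π / n) := mul_le_mul_of_nonneg_right hcard hπn.le
  have e2 : 2 * π / (n : ℝ) = π / n + π / n := by ring
  by_cases heq : lo = hi
  · subst heq
    -- `2 |S| π/n ≤ 2π/n`, impossible for `|S| ≥ n ≥ 2`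
    have h0 : t lo - t lo = 0 := sub_self _
    rw [h0] at h3
    have : (S.card : ℝ) * (π / n) ≤ 1 * (π / n) := by linarith
    have hS1 : (S.card : ℝ) ≤ 1 := le_of_mul_le_mul_right this hπn
    linarith
  · have hw := (hno lo hlo hi hhi heq (h1 hi hhi)).2
    -- `2|S|π/n ≤ (t hi − t lo) + 2π/n < 2π − 2π/n + 2π/n`
    rw [e2] at hw
    linarith

/-- **Close pair ⇒ small height product.**  Two unit vectors `u ≠ v` with `⟪u, v⟫ ≤ 1/2`, heights `u₂, v₂` of
the same sign (`u₂ v₂ ≥ 0` is not needed) and horizontal parts non-zero, whose azimuths differ by at most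
`90°` either way, satisfy `u₂ v₂ ≤ 1/2` (the horizontal contribution `ρρ' cos Δθ` is non-negative). -/
theorem height_mul_le_half_of_arc_le {u v : EuclideanSpace ℝ (Fin 3)} (hu : ‖u‖ = 1) (hv : ‖v‖ = 1)
    (huv : ⟪u, v⟫_ℝ ≤ 1 / 2) (hu2 : u 2 ^ 2 < 1) (hv2 : v 2 ^ 2 < 1)
    (hθ : Complex.arg ⟨u 0, u 1⟩ ≤ Complex.arg ⟨v 0, v 1⟩)
    (harc : Complex.arg ⟨v 0, v 1⟩ - Complex.arg ⟨u 0, u 1⟩ ≤ 2 * π / (4 : ℕ) ∨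
      2 * π - (Complex.arg ⟨v 0, v 1⟩ - Complex.arg ⟨u 0, u 1⟩) ≤ 2 * π / (4 : ℕ)) :
    u 2 * v 2 ≤ 1 / 2 := by
  set zu : ℂ := ⟨u 0, u 1⟩ with hzu
  set zv : ℂ := ⟨v 0, v 1⟩ with hzv
  have hnu0 : 0 < ‖zu‖ := by rw [hzu, norm_horiz_t7 hu]; exact Real.sqrt_pos.2 (by linarith)
  have hnv0 : 0 < ‖zv‖ := by rw [hzv, norm_horiz_t7 hv]; exact Real.sqrt_pos.2 (by linarith)
  have hin : ⟪u, v⟫_ℝ = ‖zu‖ * ‖zv‖ * Real.cos (Complex.arg zu - Complex.arg zv) + u 2 * v 2 := by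
    rw [inner_three_t7, ← re_mul_add_im_mul zu zv (norm_pos_iff.1 hnu0) (norm_pos_iff.1 hnv0)]
  -- `cos Δθ ≥ 0`
  have hcos : 0 ≤ Real.cos (Complex.arg zu - Complex.arg zv) := by
    have e : (2 : ℝ) * π / (4 : ℕ) = π / 2 := by push_cast; ring
    rw [e] at harc
    rw [← Real.cos_neg, neg_sub]
    rcases harc with h | h
    · exact Real.cos_nonneg_of_neg_pi_div_two_le_of_le (by linarith) h
    · rw [← Real.cos_two_pi_sub]
      have ha1 := Complex.arg_le_pi zv
      have ha2 := Complex.neg_pi_lt_arg zu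
      exact Real.cos_nonneg_of_neg_pi_div_two_le_of_le (by linarith [pi_pos]) h
  have : 0 ≤ ‖zu‖ * ‖zv‖ * Real.cos (Complex.arg zu - Complex.arg zv) :=
    mul_nonneg (mul_nonneg hnu0.le hnv0.le) hcos
  linarith

/-- The staircase bound with the cap-count thresholds: for `0 ≤ z ≤ c`,
`z ≤ 1/5 + (2/25)[z ≥ 1/5] + (51/200)[z ≥ 7/25] + (7/40)[z ≥ 107/200] + (c − 71/100)[z ≥ 71/100]`. -/
private theorem stair_le {z c : ℝ} (hzc : z ≤ c) :
    z ≤ 1 / 5 + (2 / 25) * (if (1 / 5 : ℝ) ≤ z then 1 else 0) + (51 / 200) * (if (7 / 25 : ℝ) ≤ z then 1 else 0) +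
      (7 / 40) * (if (107 / 200 : ℝ) ≤ z then 1 else 0) + (c - 71 / 100) * (if (71 / 100 : ℝ) ≤ z then 1 else 0) := by
  split_ifs <;> linarith

/-! ## Seven cap-zone vectors: `Σ u₂ ≤ 5c` -/

/-- **Seven `60°`-code vectors in the cap zone `0 ≤ u₂ ≤ √(2/3)` have `Σ u₂ ≤ 5√(2/3)`.** -/
theorem sum_height_le_five_of_seven (S : Finset (EuclideanSpace ℝ (Fin 3))) (h1 : ∀ u ∈ S, ‖u‖ = 1)
    (h2 : ∀ u ∈ S, ∀ v ∈ S, u ≠ v → ⟪u, v⟫_ℝ ≤ 1 / 2)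
    (hcap : ∀ u ∈ S, 0 ≤ u 2 ∧ u 2 ≤ Real.sqrt (2 / 3)) (h7 : S.card = 7) :
    ∑ u ∈ S, u 2 ≤ 5 * Real.sqrt (2 / 3) := by
  classical
  set c : ℝ := Real.sqrt (2 / 3) with hc
  have hc2 : c ^ 2 = 2 / 3 := Real.sq_sqrt (by norm_num)
  have hcpos : 0 < c := Real.sqrt_pos.2 (by norm_num)
  obtain ⟨hcl, hcu⟩ := sqrt_twoThirds_bounds
  rw [← hc] at hcl hcu
  -- the four cap counts (all members are `≤ c`, so the filters are by the lower threshold only)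
  have hfilt : ∀ t : ℝ, (S.filter fun u => t ≤ u 2 ∧ u 2 ≤ c) = S.filter fun u => t ≤ u 2 := by
    intro t; refine Finset.filter_congr fun u hu => ?_
    exact ⟨fun h => h.1, fun h => ⟨h, (hcap u hu).2⟩⟩
  have hH3 : (S.filter fun u => (71 / 100 : ℝ) ≤ u 2).card ≤ 3 := hfilt _ ▸ card_cap_ge_071_le_three S h1 h2
  have hA1 : (S.filter fun u => (107 / 200 : ℝ) ≤ u 2).card ≤ 4 := hfilt _ ▸ card_cap_ge_0535_le_four S h1 h2
  have hA2 : (S.filter fun u => (7 / 25 : ℝ) ≤ u 2).card ≤ 5 := hfilt _ ▸ card_cap_ge_028_le_five S h1 h2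
  have hA3 : (S.filter fun u => (1 / 5 : ℝ) ≤ u 2).card ≤ 6 := by
    rw [← hfilt]; exact card_cap_ge_020_le_six S h1 h2
  -- staircase sum over any `T ⊆ S`
  have hstair : ∀ T ⊆ S, ∑ u ∈ T, u 2 ≤ (T.card : ℝ) / 5 + (2 / 25) * (T.filter fun u => (1 / 5 : ℝ) ≤ u 2).card +
      (51 / 200) * (T.filter fun u => (7 / 25 : ℝ) ≤ u 2).card +
      (7 / 40) * (T.filter fun u => (107 / 200 : ℝ) ≤ u 2).card +
      (c - 71 / 100) * (T.filter fun u => (71 / 100 : ℝ) ≤ u 2).card := by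
    intro T hT
    have h := Finset.sum_le_sum fun u hu => stair_le (c := c) (hcap u (hT hu)).2
    refine h.trans (le_of_eq ?_)
    simp only [sum_add_distrib, sum_const, nsmul_eq_mul, ← mul_sum, Finset.sum_boole]
    ring
  set H := S.filter (fun u => (71 / 100 : ℝ) ≤ u 2) with hHdef
  by_cases hH : H.card ≤ 2
  · -- few high vectors: the staircase alone
    have h := hstair S (Subset.refl S)
    rw [h7] at h
    have hH' : ((S.filter fun u => (71 / 100 : ℝ) ≤ u 2).card : ℝ) ≤ 2 := by rw [← hHdef]; exact_mod_cast hH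
    have hA1' : ((S.filter fun u => (107 / 200 : ℝ) ≤ u 2).card : ℝ) ≤ 4 := by exact_mod_cast hA1
    have hA2' : ((S.filter fun u => (7 / 25 : ℝ) ≤ u 2).card : ℝ) ≤ 5 := by exact_mod_cast hA2
    have hA3' : ((S.filter fun u => (1 / 5 : ℝ) ≤ u 2).card : ℝ) ≤ 6 := by exact_mod_cast hA3
    nlinarith [hH', hA1', hA2', hA3', hcl, hcu, h]
  · -- exactly three high vectors
    push Not at hH
    have hH3' : H.card = 3 := le_antisymm hH3 (by omega)
    set R := S \ H with hRdef
    have hHS : H ⊆ S := filter_subset _ _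
    have hRS : R ⊆ S := sdiff_subset
    have hRcard : R.card = 4 := by rw [hRdef, card_sdiff_of_subset hHS, h7, hH3']
    have hRne : R.Nonempty := by rw [← Finset.card_pos, hRcard]; norm_num
    have hRlow : ∀ u ∈ R, u 2 < 71 / 100 := by
      intro u hu
      rw [hRdef, mem_sdiff, hHdef, mem_filter] at hu
      by_contra h; push Not at h; exact hu.2 ⟨hu.1, h⟩
    have hHhigh : ∀ u ∈ H, (71 / 100 : ℝ) ≤ u 2 := fun u hu => (mem_filter.1 hu).2
    -- the highest remaining vector `r`
    obtain ⟨r, hr, hrmax⟩ := Finset.exists_max_image R (fun u => u 2) hRne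
    -- among `H ∪ {r}` two are within `90°` in azimuth
    set P := insert r H with hP
    have hrH : r ∉ H := (mem_sdiff.1 hr).2
    have hPcard : 4 ≤ P.card := by rw [hP, card_insert_of_notMem hrH, hH3']
    obtain ⟨a, ha, b, hb, hab, htab, harc⟩ :=
      exists_pair_arc_le P (fun u => Complex.arg ⟨u 0, u 1⟩) (n := 4) (by norm_num) hPcard
    have hPS : P ⊆ S := by
      rw [hP]; exact insert_subset (hRS hr) hHS
    have hsq : ∀ u ∈ S, u 2 ^ 2 < 1 := by
      intro u hu; have := hcap u hu; nlinarith
    have hprod : a 2 * b 2 ≤ 1 / 2 :=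
      height_mul_le_half_of_arc_le (h1 a (hPS ha)) (h1 b (hPS hb)) (h2 a (hPS ha) b (hPS hb) hab)
        (hsq a (hPS ha)) (hsq b (hPS hb)) htab harc
    -- the close pair is `r` and a high vector `h`
    have hpair : ∃ h ∈ H, h 2 * r 2 ≤ 1 / 2 := by
      rw [hP, mem_insert] at ha hb
      rcases ha with rfl | ha <;> rcases hb with rfl | hb
      · exact absurd rfl hab
      · exact ⟨b, hb, by rw [mul_comm]; exact hprod⟩
      · exact ⟨a, ha, hprod⟩
      · exfalso
        have h1' := hHhigh a ha; have h2' := hHhigh b hb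
        nlinarith
    obtain ⟨h, hhH, hhr⟩ := hpair
    -- `z_h + z_r ≤ c + 1/(2c)`
    have hr0 : 0 ≤ r 2 := (hcap r (hRS hr)).1
    have hhc : h 2 ≤ c := (hcap h (hHS hhH)).2
    have hrc : r 2 ≤ c := (hcap r (hRS hr)).2
    have hsum_hr : c * (h 2 + r 2) ≤ c ^ 2 + 1 / 2 := by
      nlinarith [mul_nonneg (sub_nonneg.2 hhc) (sub_nonneg.2 hrc)]
    -- `Σ_H ≤ z_h + 2c`
    have hHsum : ∑ u ∈ H, u 2 ≤ h 2 + 2 * c := by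
      rw [← Finset.add_sum_erase H (fun u => u 2) hhH]
      have hle : ∑ u ∈ H.erase h, u 2 ≤ ∑ u ∈ H.erase h, c :=
        Finset.sum_le_sum fun u hu => (hcap u (hHS (mem_of_mem_erase hu))).2
      rw [sum_const, nsmul_eq_mul, card_erase_of_mem hhH, hH3'] at hle
      norm_num at hle; linarith
    -- the other three remaining vectors: staircase with reduced counts
    set R' := R.erase r with hR'def
    have hR'S : R' ⊆ S := fun u hu => hRS (mem_of_mem_erase hu)
    have hR'card : R'.card = 3 := by rw [hR'def, card_erase_of_mem hr, hRcard]
    -- counts inside `R'`: thresholds `0.535 / 0.28 / 0.2` allow `0 / 1 / 2`, and `0.71` allows `0`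
    have hcount : ∀ t : ℝ, ∀ k : ℕ, (S.filter fun u => t ≤ u 2).card ≤ k + 3 → t ≤ 71 / 100 →
        (R'.filter fun u => t ≤ u 2).card + 1 ≤ k ∨ (R'.filter fun u => t ≤ u 2).card = 0 := by
      intro t k hk ht
      by_cases hne : (R'.filter fun u => t ≤ u 2).Nonempty
      · left
        -- then `r` itself is `≥ t`, and `H ⊆ filter`, all disjoint from `R'`
        obtain ⟨u, hu⟩ := hne
        rw [mem_filter] at hu
        have hrt : t ≤ r 2 := hu.2.trans (hrmax u (mem_of_mem_erase hu.1))
        have hsub : insert r (H ∪ R'.filter fun u => t ≤ u 2) ⊆ S.filter fun u => t ≤ u 2 := by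
          intro x hx
          rw [mem_insert, mem_union] at hx
          rw [mem_filter]
          rcases hx with rfl | hx | hx
          · exact ⟨hRS hr, hrt⟩
          · exact ⟨hHS hx, ht.trans (hHhigh x hx)⟩
          · exact ⟨hR'S (mem_filter.1 hx).1, (mem_filter.1 hx).2⟩
        have hdisj : Disjoint H (R'.filter fun u => t ≤ u 2) := by
          rw [Finset.disjoint_left]
          intro x hxH hxR
          have := (mem_sdiff.1 (mem_of_mem_erase (mem_filter.1 hxR).1)).2
          exact this hxH
        have hrnot : r ∉ H ∪ R'.filter fun u => t ≤ u 2 := by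
          rw [mem_union, not_or]
          exact ⟨hrH, fun h => Finset.notMem_erase r R (mem_filter.1 h).1⟩
        have hc := card_le_card hsub
        rw [card_insert_of_notMem hrnot, card_union_of_disjoint hdisj, hH3'] at hc
        omega
      · right
        rwa [Finset.not_nonempty_iff_eq_empty, ← Finset.card_eq_zero] at hne
    have hB1 : (R'.filter fun u => (107 / 200 : ℝ) ≤ u 2).card = 0 := by
      rcases hcount (107 / 200) 1 (by omega) (by norm_num) with h | h <;> omega
    have hB2 : (R'.filter fun u => (7 / 25 : ℝ) ≤ u 2).card ≤ 1 := by
      rcases hcount (7 / 25) 2 (by omega) (by norm_num) with h | h <;> omega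
    have hB3 : (R'.filter fun u => (1 / 5 : ℝ) ≤ u 2).card ≤ 2 := by
      rcases hcount (1 / 5) 3 (by omega) (by norm_num) with h | h <;> omega
    have hB0 : (R'.filter fun u => (71 / 100 : ℝ) ≤ u 2).card = 0 := by
      rw [Finset.card_eq_zero, Finset.filter_eq_empty_iff]
      intro u hu
      exact not_le.2 (hRlow u (mem_of_mem_erase hu))
    have hR'sum := hstair R' hR'S
    rw [hR'card, hB1, hB0] at hR'sum
    have hB2' : ((R'.filter fun u => (7 / 25 : ℝ) ≤ u 2).card : ℝ) ≤ 1 := by exact_mod_cast hB2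
    have hB3' : ((R'.filter fun u => (1 / 5 : ℝ) ≤ u 2).card : ℝ) ≤ 2 := by exact_mod_cast hB3
    -- assemble: `Σ_S = Σ_H + z_r + Σ_{R'}`
    have hsplit : ∑ u ∈ S, u 2 = ∑ u ∈ H, u 2 + (r 2 + ∑ u ∈ R', u 2) := by
      rw [← Finset.sum_sdiff hHS, add_comm, ← hRdef, ← Finset.add_sum_erase R (fun u => u 2) hr]
    rw [hsplit]
    push_cast at hR'sum
    have hR'b : ∑ u ∈ R', u 2 ≤ 203 / 200 := by nlinarith [hR'sum, hB2', hB3', hcl, hcu]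
    have hX : c * (h 2 + r 2 + ∑ u ∈ R', u 2) ≤ c * (3 * c) := by
      have := mul_le_mul_of_nonneg_left hR'b hcpos.le
      nlinarith [hsum_hr, hc2, hcu]
    have hX' : h 2 + r 2 + ∑ u ∈ R', u 2 ≤ 3 * c := le_of_mul_le_mul_left hX hcpos
    linarith [hHsum, hX']

/-! ## Reflection to the lower band and the row -/

/-- Reflection in the equatorial plane (negate the third coordinate): the third coordinate. -/
private theorem reflZ_apply_two (u : EuclideanSpace ℝ (Fin 3)) :
    ((u - (2 * u 2) • EuclideanSpace.single 2 (1 : ℝ) : EuclideanSpace ℝ (Fin 3))) 2 = -u 2 := by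
  simp; ring

/-- Reflection in the equatorial plane: first coordinate unchanged. -/
private theorem reflZ_apply_zero (u : EuclideanSpace ℝ (Fin 3)) :
    ((u - (2 * u 2) • EuclideanSpace.single 2 (1 : ℝ) : EuclideanSpace ℝ (Fin 3))) 0 = u 0 := by
  simp [PiLp.sub_apply, PiLp.smul_apply]

/-- Reflection in the equatorial plane: second coordinate unchanged. -/
private theorem reflZ_apply_one (u : EuclideanSpace ℝ (Fin 3)) :
    ((u - (2 * u 2) • EuclideanSpace.single 2 (1 : ℝ) : EuclideanSpace ℝ (Fin 3))) 1 = u 1 := by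
  simp [PiLp.sub_apply, PiLp.smul_apply]

/-- The reflection preserves inner products. -/
private theorem inner_reflZ (u v : EuclideanSpace ℝ (Fin 3)) :
    ⟪((u - (2 * u 2) • EuclideanSpace.single 2 (1 : ℝ) : EuclideanSpace ℝ (Fin 3))), ((v - (2 * v 2) • EuclideanSpace.single 2 (1 : ℝ) : EuclideanSpace ℝ (Fin 3)))⟫_ℝ = ⟪u, v⟫_ℝ := by
  rw [inner_three_t7, inner_three_t7 u v, reflZ_apply_zero, reflZ_apply_zero, reflZ_apply_one, reflZ_apply_one,
    reflZ_apply_two, reflZ_apply_two]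
  ring

/-- The reflection preserves norms. -/
private theorem norm_reflZ (u : EuclideanSpace ℝ (Fin 3)) : ‖((u - (2 * u 2) • EuclideanSpace.single 2 (1 : ℝ) : EuclideanSpace ℝ (Fin 3)))‖ = ‖u‖ := by
  have h1 := real_inner_self_eq_norm_sq ((u - (2 * u 2) • EuclideanSpace.single 2 (1 : ℝ) : EuclideanSpace ℝ (Fin 3)))
  have h2 := real_inner_self_eq_norm_sq u
  rw [inner_reflZ] at h1
  nlinarith [norm_nonneg ((u - (2 * u 2) • EuclideanSpace.single 2 (1 : ℝ) : EuclideanSpace ℝ (Fin 3))), norm_nonneg u]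

/-- The reflection is an involution. -/
private theorem reflZ_invol (u : EuclideanSpace ℝ (Fin 3)) :
    (((u - (2 * u 2) • EuclideanSpace.single 2 (1 : ℝ) : EuclideanSpace ℝ (Fin 3)) -
        (2 * ((u - (2 * u 2) • EuclideanSpace.single 2 (1 : ℝ) : EuclideanSpace ℝ (Fin 3))) 2) •
          EuclideanSpace.single 2 (1 : ℝ)) : EuclideanSpace ℝ (Fin 3)) = u := by
  rw [reflZ_apply_two]
  ext i
  fin_cases i <;> simp

/-- The reflection is injective. -/
private theorem reflZ_injective :
    Function.Injective (fun u : EuclideanSpace ℝ (Fin 3) =>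
      ((u - (2 * u 2) • EuclideanSpace.single 2 (1 : ℝ) : EuclideanSpace ℝ (Fin 3)))) := by
  intro u v h
  have h' := congrArg (fun w : EuclideanSpace ℝ (Fin 3) =>
    ((w - (2 * w 2) • EuclideanSpace.single 2 (1 : ℝ) : EuclideanSpace ℝ (Fin 3)))) h
  simp only at h'
  rwa [reflZ_invol, reflZ_invol] at h'

/-- **Seven `60°`-code vectors in the lower band `−√(2/3) ≤ u₂ ≤ 0` have `Σ |u₂| ≤ 5√(2/3)`** (reflection of
`sum_height_le_five_of_seven`). -/
theorem sum_depth_le_five_of_seven (S : Finset (EuclideanSpace ℝ (Fin 3))) (h1 : ∀ u ∈ S, ‖u‖ = 1)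
    (h2 : ∀ u ∈ S, ∀ v ∈ S, u ≠ v → ⟪u, v⟫_ℝ ≤ 1 / 2)
    (hband : ∀ u ∈ S, -Real.sqrt (2 / 3) ≤ u 2 ∧ u 2 ≤ 0) (h7 : S.card = 7) :
    ∑ u ∈ S, -u 2 ≤ 5 * Real.sqrt (2 / 3) := by
  classical
  set S' := S.image (fun u : EuclideanSpace ℝ (Fin 3) =>
    ((u - (2 * u 2) • EuclideanSpace.single 2 (1 : ℝ) : EuclideanSpace ℝ (Fin 3)))) with hS'
  have hcard : S'.card = 7 := by rw [hS', card_image_of_injective _ reflZ_injective, h7]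
  have h1' : ∀ u ∈ S', ‖u‖ = 1 := by
    intro u hu; obtain ⟨x, hx, rfl⟩ := mem_image.1 hu; rw [norm_reflZ]; exact h1 x hx
  have h2' : ∀ u ∈ S', ∀ v ∈ S', u ≠ v → ⟪u, v⟫_ℝ ≤ 1 / 2 := by
    intro u hu v hv huv
    obtain ⟨x, hx, rfl⟩ := mem_image.1 hu
    obtain ⟨y, hy, rfl⟩ := mem_image.1 hv
    rw [inner_reflZ]
    exact h2 x hx y hy fun h => huv (by rw [h])
  have hcap' : ∀ u ∈ S', 0 ≤ u 2 ∧ u 2 ≤ Real.sqrt (2 / 3) := by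
    intro u hu; obtain ⟨x, hx, rfl⟩ := mem_image.1 hu
    rw [reflZ_apply_two]; constructor <;> linarith [(hband x hx).1, (hband x hx).2]
  have h := sum_height_le_five_of_seven S' h1' h2' hcap' hcard
  rw [hS', sum_image fun x _ y _ h => reflZ_injective h] at h
  simpa only [reflZ_apply_two] using h

/-- The third coordinate is the `e₃`-height (local copy). -/
private theorem inner_e3_t7 (v : EuclideanSpace ℝ (Fin 3)) :
    ⟪EuclideanSpace.single 2 (1 : ℝ), v⟫_ℝ = v 2 := by
  rw [real_inner_comm, EuclideanSpace.inner_single_right]; simp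

/-- **The top-ball row of `ConfinedCodeBoundPhys √(2/3) ramp` for seven partners.**  At the offset
`a = −√(2/3)` a finite `60°`-code `N` with `|N| = 7` each of whose members has third coordinate `−2√(2/3)` (void)
or in `[−√(2/3), 0]` has ramp weight `Σ (1 + |u₂|/√(2/3)) ≤ 12`. -/
theorem topRow_ramp_seven (N : Finset (EuclideanSpace ℝ (Fin 3))) (h1 : ∀ u ∈ N, ‖u‖ = 1)
    (h2 : ∀ u ∈ N, ∀ v ∈ N, u ≠ v → ⟪u, v⟫_ℝ ≤ 1 / 2)
    (hwin : ∀ u ∈ N, u 2 = -Real.sqrt (2 / 3) - Real.sqrt (2 / 3) ∨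
      (-Real.sqrt (2 / 3) ≤ u 2 ∧ u 2 ≤ -Real.sqrt (2 / 3) + Real.sqrt (2 / 3)))
    (h7 : N.card = 7) :
    ∑ u ∈ N, min 2 (max 0 (1 - u 2 / Real.sqrt (2 / 3))) ≤ 12 := by
  classical
  set c : ℝ := Real.sqrt (2 / 3) with hc
  have hc2 : c ^ 2 = 2 / 3 := Real.sq_sqrt (by norm_num)
  have hcpos : 0 < c := Real.sqrt_pos.2 (by norm_num)
  have hc1 : 1 < 2 * c := by nlinarith
  have hband : ∀ u ∈ N, -c ≤ u 2 ∧ u 2 ≤ 0 := by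
    intro u hu
    rcases hwin u hu with h | h
    · exfalso
      have habs : |u 2| ≤ 1 := by
        have := abs_real_inner_le_norm (EuclideanSpace.single 2 (1 : ℝ)) u
        rw [inner_e3_t7, PiLp.norm_single, norm_one, one_mul, h1 u hu] at this
        exact this
      rw [h, abs_le] at habs
      linarith [habs.1]
    · exact ⟨h.1, by linarith [h.2]⟩
  have hg : ∀ u ∈ N, min 2 (max 0 (1 - u 2 / c)) = 1 + (-u 2) / c := by
    intro u hu
    have h := hband u hu
    have hlo : 0 ≤ 1 - u 2 / c := by
      have : u 2 / c ≤ 0 := div_nonpos_of_nonpos_of_nonneg h.2 hcpos.le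
      linarith
    have hhi : 1 - u 2 / c ≤ 2 := by
      have : -1 ≤ u 2 / c := by rw [le_div_iff₀ hcpos]; linarith [h.1]
      linarith
    rw [max_eq_right hlo, min_eq_right hhi, neg_div]; ring
  have hsum := sum_depth_le_five_of_seven N h1 h2 hband h7
  rw [Finset.sum_neg_distrib] at hsum
  have hdiv : ∑ u ∈ N, -u 2 / c = (-∑ u ∈ N, u 2) / c := by rw [← Finset.sum_neg_distrib, Finset.sum_div]
  have h5 : (-∑ u ∈ N, u 2) / c ≤ 5 := by rw [div_le_iff₀ hcpos]; linarith
  rw [Finset.sum_congr rfl hg, sum_add_distrib, sum_const, h7, hdiv]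
  norm_num
  linarith

end Summit.Ventures.Crystal3D.Theorems

end
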